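import Summits.AtomisticToContinuum.HydrodynamicLimit.Theses.BallwiseInvariantReferences

/-!
# Birth skeleton for crux `BallwiseSufficiency` (stmt-AtomisticToContinuum-13023)
Route `BallwiseInvariantReferences` (sub-problem `HydrodynamicLimit`), published as
`Cruxes/BallwiseSufficiency/Lines/birth.lean`.

The crux is the implication
`LocalFluxGibbsianity → EnergyCurrentTails → FastCollisionThroughput → RelEntropyVanishing`
(Yau's relative-entropy method with BALL-WISE INVARIANT Gibbs references). Its proof has three
layers of genuinely different nature, which are the three registered stubs:

* `stub_eulerReferenceFamily` — the STATIC layer (size M–L; low-density cluster-expansion large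
  deviations + inverse equation of state, the 0767/0768-type inputs of the route text): along every
  classical hs-Euler solution there is a smooth positive activity field `a : ℝ → 𝕋³ → ℝ` such that the
  local Gibbs law `ψ_t^N = localGibbs(a t, u t, θ t)` is a probability measure whose empirical
  density / momentum / energy fields concentrate exponentially around the Euler fields `(ρ, ρu, E)(t)`
  (`IsEulerReference`); and the initial local Gibbs laws are probability measures.
* `stub_initialEntropy` — the INITIAL LAYER / parameter identification (size M): if the fields of
  `localGibbs(a₀,u₀,θ₀)` converge at `t = 0` to the Euler data and a continuous positive activity `a`
  makes `localGibbs(a, u 0, θ 0)` concentrate around the same data, then the specific relative entropy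
  `H(localGibbs(a₀,u₀,θ₀) | localGibbs(a, u 0, θ 0))/(N+1) → 0` (LLN uniqueness forces `u₀ = u 0`,
  `θ₀ = θ 0` and `a ∝ a₀` at low packing, where activity ↦ density is injective up to constants).
* `stub_entropyPropagation` — the DYNAMIC layer, the heart (size XL; Yau's Gronwall for
  `H(f_t | ψ_t)` with the one-block term handled ball-wise against invariant homogeneous Gibbs
  references, fed by `LocalFluxGibbsianity`, with truncation errors paid by `EnergyCurrentTails` and
  `FastCollisionThroughput`): for ANY Euler reference family and initial entropy `o(N)`,
  `H(f_t | ψ_t)/(N+1) → 0` for every `t < T`.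

`BallwiseSufficiency_of` composes them into the crux BY NAME (pure logic: minimum of the three `σ₀`,
thread the reference family; no sorry). No stub is the crux or the summit in disguise: the static stub
has no dynamics, the initial stub no time evolution, and the dynamic stub cannot produce the reference
family or its concentration (BC3 probes `stub → BallwiseSufficiency`, `stub → _root_.HydrodynamicLimit`
by `first | exact? | simpa | aesop` fail for all three; see the registrar's NOTES.md).
-/

noncomputable section

namespace Summit.AtomisticToContinuum.HydrodynamicLimit.Cruxes.BallwiseSufficiency.Birth

open MeasureTheory Filter Set
open Literature.MathematicalPhysics.KineticTheory
open Summit.AtomisticToContinuum.HydrodynamicLimit.Theses.BallwiseInvariantReferences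

/-- Families of hard-sphere flows of `N + 1` spheres of diameter `σ (N+1)^{-1/3}` on `𝕋³`. -/
abbrev Flows (σ : ℝ) : Type :=
  (N : ℕ) → Literature.Analysis.FluidPDE.HardSphereFlow
    (Literature.Analysis.FluidPDE.Torus.geometry (Fin 3)) (hsDiameter σ N) (N + 1)

/-- Exponential concentration of the empirical density / momentum / energy fields of the local Gibbs
law `localGibbs(a, u', θ')` around the macroscopic fields `(ρ', ρ'u', E(ρ',u',θ'))` — verbatim the
static conjunct of `RelEntropyVanishing` with `(a, ρ t, θ t, u t)` abstracted. -/
def Concentrates (σ : ℝ) (a ρ' θ' : T3 → ℝ) (u' : T3 → V3) (Φ : Flows σ) : Prop :=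
  ∀ χ : T3 → ℝ, Continuous χ → ∀ δ : ℝ, 0 < δ → ∃ C : ℝ, 0 < C ∧ ∀ N : ℕ,
    localGibbsLaw σ a u' θ' N (Φ N)
        {z | δ < |empiricalDensityField z χ - ∫ x, χ x * ρ' x|}
        ≤ ENNReal.ofReal (C * Real.exp (-(C⁻¹ * (N + 1)))) ∧
    localGibbsLaw σ a u' θ' N (Φ N)
        {z | δ < ‖empiricalMomentumField z χ - ∫ x, (χ x * ρ' x) • u' x‖}
        ≤ ENNReal.ofReal (C * Real.exp (-(C⁻¹ * (N + 1)))) ∧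
    localGibbsLaw σ a u' θ' N (Φ N)
        {z | δ < |empiricalEnergyField z χ - ∫ x, χ x * totalEnergyDensity (ρ' x) (u' x) (θ' x)|}
        ≤ ENNReal.ofReal (C * Real.exp (-(C⁻¹ * (N + 1))))

/-- An EULER REFERENCE FAMILY for the classical solution `(ρ, u, θ)` on `[0, T)`: an activity field
`a : ℝ → 𝕋³ → ℝ`, jointly smooth on `[0,T) × 𝕋³`, each slice continuous and positive, such that the
local Gibbs law `localGibbs(a t, u t, θ t)` is a probability measure concentrating exponentially
around the Euler fields at every `t ∈ [0, T)` (the ball-wise / local-equilibrium reference `ψ_t`). -/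
def IsEulerReference (σ T : ℝ) (ρ θ : ℝ → T3 → ℝ) (u : ℝ → T3 → V3) (Φ : Flows σ)
    (a : ℝ → T3 → ℝ) : Prop :=
  Literature.Analysis.FunctionSpaces.Torus.IsSmoothSpaceTimeOn (Ico 0 T) a ∧
  ∀ t ∈ Ico 0 T, Continuous (a t) ∧ (∀ x, 0 < a t x) ∧
    (∀ N, IsProbabilityMeasure (localGibbsLaw σ (a t) (u t) (θ t) N (Φ N))) ∧
    Concentrates σ (a t) (ρ t) (θ t) (u t) Φ

/-! ## Registered stubs -/

/-- **Stub S — static layer: Euler reference families exist.** For continuous positive profiles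
there is `σ₀ > 0` such that for `0 < σ < σ₀`, every classical hs-Euler solution on `[0,T)` and every
flow family: the initial local Gibbs laws are probability measures, and if their fields converge at
`t = 0` to the Euler data then an Euler reference family exists (inverse equation of state
`a_t ∝ EOS⁻¹(ρ_t, θ_t)` at low packing + static large deviations for the inhomogeneous low-density
canonical hard-sphere gas + Gaussian velocity concentration). Where the unguarded crux meets
imploding (high-packing) solutions, this is the stub that carries it. -/
theorem stub_eulerReferenceFamily :
    ∀ (a₀ θ₀ : T3 → ℝ) (u₀ : T3 → V3), Continuous a₀ → Continuous θ₀ → Continuous u₀ →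
      (∀ x, 0 < a₀ x) → (∀ x, 0 < θ₀ x) →
      ∃ σ₀ : ℝ, 0 < σ₀ ∧ ∀ σ : ℝ, 0 < σ → σ < σ₀ →
        ∀ (T : ℝ) (ρ θ : ℝ → T3 → ℝ) (u : ℝ → T3 → V3), IsHardSphereEulerSolution σ T ρ u θ →
          ∀ Φ : Flows σ,
            (∀ N, IsProbabilityMeasure (localGibbsLaw σ a₀ u₀ θ₀ N (Φ N))) ∧
            (TendstoHydroFieldsAt (fun N => localGibbsLaw σ a₀ u₀ θ₀ N (Φ N)) Φ ρ u θ 0 →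
              ∃ a : ℝ → T3 → ℝ, IsEulerReference σ T ρ θ u Φ a) := by
  sorry

/-- **Stub I — initial layer: parameter identification gives initial entropy `o(N)`.** If the
fields of `localGibbs(a₀,u₀,θ₀)` converge at time `0` to the Euler data `(ρ 0, u 0, θ 0)` and a
continuous positive activity `a` makes `localGibbs(a, u 0, θ 0)` a probability measure concentrating
around the same data, then `H(localGibbs(a₀,u₀,θ₀) ‖ localGibbs(a, u 0, θ 0))/(N+1) → 0` (indeed the
two laws coincide: `u₀ = u 0`, `θ₀ = θ 0` by uniqueness of limits in probability and continuity, and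
`a = c • a₀` because activity ↦ density is injective up to constants at low packing). -/
theorem stub_initialEntropy :
    ∀ (a₀ θ₀ : T3 → ℝ) (u₀ : T3 → V3), Continuous a₀ → Continuous θ₀ → Continuous u₀ →
      (∀ x, 0 < a₀ x) → (∀ x, 0 < θ₀ x) →
      ∃ σ₀ : ℝ, 0 < σ₀ ∧ ∀ σ : ℝ, 0 < σ → σ < σ₀ →
        ∀ (T : ℝ) (ρ θ : ℝ → T3 → ℝ) (u : ℝ → T3 → V3), IsHardSphereEulerSolution σ T ρ u θ →
          0 < T → ∀ Φ : Flows σ,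
            (∀ N, IsProbabilityMeasure (localGibbsLaw σ a₀ u₀ θ₀ N (Φ N))) →
            TendstoHydroFieldsAt (fun N => localGibbsLaw σ a₀ u₀ θ₀ N (Φ N)) Φ ρ u θ 0 →
            ∀ a : T3 → ℝ, Continuous a → (∀ x, 0 < a x) →
              (∀ N, IsProbabilityMeasure (localGibbsLaw σ a (u 0) (θ 0) N (Φ N))) →
              Concentrates σ a (ρ 0) (θ 0) (u 0) Φ →
              Tendsto (fun N : ℕ => InformationTheory.klDiv (localGibbsLaw σ a₀ u₀ θ₀ N (Φ N))
                  (localGibbsLaw σ a (u 0) (θ 0) N (Φ N)) / ((N : ENNReal) + 1))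
                atTop (nhds 0) := by
  sorry

/-- **Stub D — dynamic layer: Yau's entropy propagation with ball-wise invariant references
(the heart of the line).** Under `LocalFluxGibbsianity`, `EnergyCurrentTails` and
`FastCollisionThroughput`: for continuous positive profiles there is `σ₀ > 0` such that for
`0 < σ < σ₀`, every classical solution, every flow family with probability initial local Gibbs laws
whose fields converge at `t = 0`, EVERY Euler reference family `a` and initial entropy `o(N)`
relative to `localGibbs(a 0, u 0, θ 0)`, the relative entropy of the evolved law with respect to
`localGibbs(a t, u t, θ t)` is `o(N)` for every `t ∈ [0,T)` (torus Gronwall; one-block term by the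
ball-wise entropy inequality against invariant homogeneous Gibbs references at the balls' own Euler
parameters, entropy mismatch `N_B(C r² + C r √h_B)`, window pressures from LFG, truncation errors from
the two tail inputs, then `r → 0`). -/
theorem stub_entropyPropagation :
    LocalFluxGibbsianity → EnergyCurrentTails → FastCollisionThroughput →
    ∀ (a₀ θ₀ : T3 → ℝ) (u₀ : T3 → V3), Continuous a₀ → Continuous θ₀ → Continuous u₀ →
      (∀ x, 0 < a₀ x) → (∀ x, 0 < θ₀ x) →
      ∃ σ₀ : ℝ, 0 < σ₀ ∧ ∀ σ : ℝ, 0 < σ → σ < σ₀ →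
        ∀ (T : ℝ) (ρ θ : ℝ → T3 → ℝ) (u : ℝ → T3 → V3), IsHardSphereEulerSolution σ T ρ u θ →
          ∀ Φ : Flows σ,
            (∀ N, IsProbabilityMeasure (localGibbsLaw σ a₀ u₀ θ₀ N (Φ N))) →
            TendstoHydroFieldsAt (fun N => localGibbsLaw σ a₀ u₀ θ₀ N (Φ N)) Φ ρ u θ 0 →
            ∀ a : ℝ → T3 → ℝ, IsEulerReference σ T ρ θ u Φ a →
              Tendsto (fun N : ℕ => InformationTheory.klDiv (localGibbsLaw σ a₀ u₀ θ₀ N (Φ N))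
                  (localGibbsLaw σ (a 0) (u 0) (θ 0) N (Φ N)) / ((N : ENNReal) + 1))
                atTop (nhds 0) →
              ∀ t ∈ Ico 0 T,
                Tendsto (fun N : ℕ => InformationTheory.klDiv
                    ((Φ N).lawAt (localGibbsLaw σ a₀ u₀ θ₀ N (Φ N)) t)
                    (localGibbsLaw σ (a t) (u t) (θ t) N (Φ N)) / ((N : ENNReal) + 1))
                  atTop (nhds 0) := by
  sorry

/-! ## Registered stub statements (reducible aliases, so the composition's type is literally
`stub₁-sig → stub₂-sig → stub₃-sig → BallwiseSufficiency`) -/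

namespace Registered

/-- Statement of `stub_eulerReferenceFamily`. -/
abbrev stub_eulerReferenceFamily : Prop :=
    ∀ (a₀ θ₀ : T3 → ℝ) (u₀ : T3 → V3), Continuous a₀ → Continuous θ₀ → Continuous u₀ →
      (∀ x, 0 < a₀ x) → (∀ x, 0 < θ₀ x) →
      ∃ σ₀ : ℝ, 0 < σ₀ ∧ ∀ σ : ℝ, 0 < σ → σ < σ₀ →
        ∀ (T : ℝ) (ρ θ : ℝ → T3 → ℝ) (u : ℝ → T3 → V3), IsHardSphereEulerSolution σ T ρ u θ →
          ∀ Φ : Flows σ,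
            (∀ N, IsProbabilityMeasure (localGibbsLaw σ a₀ u₀ θ₀ N (Φ N))) ∧
            (TendstoHydroFieldsAt (fun N => localGibbsLaw σ a₀ u₀ θ₀ N (Φ N)) Φ ρ u θ 0 →
              ∃ a : ℝ → T3 → ℝ, IsEulerReference σ T ρ θ u Φ a)

/-- Statement of `stub_initialEntropy`. -/
abbrev stub_initialEntropy : Prop :=
    ∀ (a₀ θ₀ : T3 → ℝ) (u₀ : T3 → V3), Continuous a₀ → Continuous θ₀ → Continuous u₀ →
      (∀ x, 0 < a₀ x) → (∀ x, 0 < θ₀ x) →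
      ∃ σ₀ : ℝ, 0 < σ₀ ∧ ∀ σ : ℝ, 0 < σ → σ < σ₀ →
        ∀ (T : ℝ) (ρ θ : ℝ → T3 → ℝ) (u : ℝ → T3 → V3), IsHardSphereEulerSolution σ T ρ u θ →
          0 < T → ∀ Φ : Flows σ,
            (∀ N, IsProbabilityMeasure (localGibbsLaw σ a₀ u₀ θ₀ N (Φ N))) →
            TendstoHydroFieldsAt (fun N => localGibbsLaw σ a₀ u₀ θ₀ N (Φ N)) Φ ρ u θ 0 →
            ∀ a : T3 → ℝ, Continuous a → (∀ x, 0 < a x) →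
              (∀ N, IsProbabilityMeasure (localGibbsLaw σ a (u 0) (θ 0) N (Φ N))) →
              Concentrates σ a (ρ 0) (θ 0) (u 0) Φ →
              Tendsto (fun N : ℕ => InformationTheory.klDiv (localGibbsLaw σ a₀ u₀ θ₀ N (Φ N))
                  (localGibbsLaw σ a (u 0) (θ 0) N (Φ N)) / ((N : ENNReal) + 1))
                atTop (nhds 0)

/-- Statement of `stub_entropyPropagation`. -/
abbrev stub_entropyPropagation : Prop :=
    LocalFluxGibbsianity → EnergyCurrentTails → FastCollisionThroughput →
    ∀ (a₀ θ₀ : T3 → ℝ) (u₀ : T3 → V3), Continuous a₀ → Continuous θ₀ → Continuous u₀ →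
      (∀ x, 0 < a₀ x) → (∀ x, 0 < θ₀ x) →
      ∃ σ₀ : ℝ, 0 < σ₀ ∧ ∀ σ : ℝ, 0 < σ → σ < σ₀ →
        ∀ (T : ℝ) (ρ θ : ℝ → T3 → ℝ) (u : ℝ → T3 → V3), IsHardSphereEulerSolution σ T ρ u θ →
          ∀ Φ : Flows σ,
            (∀ N, IsProbabilityMeasure (localGibbsLaw σ a₀ u₀ θ₀ N (Φ N))) →
            TendstoHydroFieldsAt (fun N => localGibbsLaw σ a₀ u₀ θ₀ N (Φ N)) Φ ρ u θ 0 →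
            ∀ a : ℝ → T3 → ℝ, IsEulerReference σ T ρ θ u Φ a →
              Tendsto (fun N : ℕ => InformationTheory.klDiv (localGibbsLaw σ a₀ u₀ θ₀ N (Φ N))
                  (localGibbsLaw σ (a 0) (u 0) (θ 0) N (Φ N)) / ((N : ENNReal) + 1))
                atTop (nhds 0) →
              ∀ t ∈ Ico 0 T,
                Tendsto (fun N : ℕ => InformationTheory.klDiv
                    ((Φ N).lawAt (localGibbsLaw σ a₀ u₀ θ₀ N (Φ N)) t)
                    (localGibbsLaw σ (a t) (u t) (θ t) N (Φ N)) / ((N : ENNReal) + 1))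
                  atTop (nhds 0)

end Registered

/-- The registered stubs prove their registered statements (definitional sanity check). -/
example : Registered.stub_eulerReferenceFamily := stub_eulerReferenceFamily
example : Registered.stub_initialEntropy := stub_initialEntropy
example : Registered.stub_entropyPropagation := stub_entropyPropagation

/-! ## The kernel-checked composition -/

/-- **Composition (no sorry):** static layer → initial layer → dynamic layer → the crux
`BallwiseSufficiency`, by name. Pure logic: take the minimum of the three `σ₀`; the static stub gives
the probability clause and, under field convergence at `t = 0`, an Euler reference family `a`; the
initial stub (at `a 0`, using `0 < T` from `t ∈ [0,T)`) gives initial entropy `o(N)`; the dynamic stub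
gives `H(f_t | ψ_t) = o(N)`; the reference family's clauses at time `t` are the remaining conjuncts of
`RelEntropyVanishing`. -/
theorem BallwiseSufficiency_of :
    Registered.stub_eulerReferenceFamily → Registered.stub_initialEntropy →
      Registered.stub_entropyPropagation →
      Summit.AtomisticToContinuum.HydrodynamicLimit.Theses.BallwiseInvariantReferences.BallwiseSufficiency := by
  intro hS hI hD hLFG hECT hFCT a₀ θ₀ u₀ hca hcθ hcu hap hθp
  obtain ⟨σ₁, hσ₁, H₁⟩ := hS a₀ θ₀ u₀ hca hcθ hcu hap hθp
  obtain ⟨σ₂, hσ₂, H₂⟩ := hI a₀ θ₀ u₀ hca hcθ hcu hap hθp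
  obtain ⟨σ₃, hσ₃, H₃⟩ := hD hLFG hECT hFCT a₀ θ₀ u₀ hca hcθ hcu hap hθp
  refine ⟨min σ₁ (min σ₂ σ₃), lt_min hσ₁ (lt_min hσ₂ hσ₃), ?_⟩
  intro σ hσ hσlt T ρ θ u hsol Φ
  have h₁ : σ < σ₁ := lt_of_lt_of_le hσlt (min_le_left _ _)
  have h₂ : σ < σ₂ := lt_of_lt_of_le hσlt ((min_le_right _ _).trans (min_le_left _ _))
  have h₃ : σ < σ₃ := lt_of_lt_of_le hσlt ((min_le_right _ _).trans (min_le_right _ _))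
  obtain ⟨hprob, href⟩ := H₁ σ hσ h₁ T ρ θ u hsol Φ
  refine ⟨hprob, fun h0 t ht => ?_⟩
  obtain ⟨a, ha⟩ := href h0
  have hT : (0 : ℝ) < T := lt_of_le_of_lt ht.1 ht.2
  have h0mem : (0 : ℝ) ∈ Ico 0 T := ⟨le_rfl, hT⟩
  have hslice := ha.2
  obtain ⟨hc0, hp0, hP0, hconc0⟩ := hslice 0 h0mem
  have hinit := H₂ σ hσ h₂ T ρ θ u hsol hT Φ hprob h0 (a 0) hc0 hp0 hP0 hconc0
  have hdyn := H₃ σ hσ h₃ T ρ θ u hsol Φ hprob h0 a ha hinit t ht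
  obtain ⟨_, _, hPt, hconct⟩ := hslice t ht
  exact ⟨a t, hPt, hconct, hdyn⟩

end Summit.AtomisticToContinuum.HydrodynamicLimit.Cruxes.BallwiseSufficiency.Birth

end
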